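import Summits.HodgeConjecture.HodgeConjecture.Theorems.SiegelUniversalFamilyHodgeFrames
import Literature.AlgebraicGeometry.ModuliOfAbelianVarieties.SiegelAdmissibleOfLevelReading
import Literature.AlgebraicGeometry.ModuliOfAbelianVarieties.SiegelPointOfHodgeFrame
import Literature.AlgebraicGeometry.ModuliOfAbelianVarieties.SymplecticLiftOfMarking
import Literature.AlgebraicGeometry.ModuliOfAbelianVarieties.SiegelPairingReadOfTypeFrame
import Literature.AlgebraicGeometry.HodgeTheory.HodgeFramesOfChartBallFramesAlgebraicChart
import Literature.AlgebraicGeometry.HodgeTheory.HodgeFrameTransportOfIso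
import Literature.AlgebraicGeometry.HodgeTheory.FlatFrameCoordinates
import Literature.AlgebraicGeometry.HodgeTheory.QbarFamilyLocalSystem
import Literature.AlgebraicGeometry.HodgeTheory.HodgeGenericTypeStabilityOfGenericPoint
import Literature.AlgebraicGeometry.HodgeTheory.AbelianVarietyHodgeFullnessOfUniformisation
import Literature.AlgebraicGeometry.Motives.AlgebraicChartAnalyticTransfer
import Literature.AlgebraicGeometry.Motives.AbelianVarietyAmpleRiemannForm
import Literature.AlgebraicGeometry.Motives.ComplexPointsManifold
import Literature.AlgebraicGeometry.HodgeTheory.FermatHypersurfaceReduction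
import Literature.Analysis.Matrix.CramerRuleHolomorphic
import HarnessLib

/-!
# U-e P4 (B1b), part 1: per-fibre markings of Gram `E_δ` and the LOCAL PERIOD FORMULA `π = Δ · P_μ⁻¹ · P_λ` with
# chart-analytic `P` for the universal family over the Siegel fine moduli scheme

Cell hodgecm-mathlib (D-0151), rung 0 of the Mumford line under `HDel` (item `stmt-HodgeConjecture-24835`), (U)-lane node
U-e, socket P4, third layer v0.7 (P4 lead B-p03; socket texts B-typ02): the two engines of the socket (B1b)
`UHead.Ue_P4b1b_hodgeFrameMarkings`, whose head is assembled in `Theorems/UeP4bHodgeFrameMarkings.lean`.  HC_CM is proved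
only modulo the 7 printed citations until rung 0 closes; nothing in this file changes that count (a (U)-road leaf, books 0).

* §1 currency transport (`gramClause_of_marking`, `gramClause_to_marking`, `frameClause_to_marking`): statements about a
  marking's own uniformisation `(m.Ψ, m.toFun)` versus an equal one `(Φ, φ)` (destructure, `subst`, `funext`).
* §2 `exists_marking_of_gramClause` — PER FIBRE ([Milne2005ShimuraVarieties] proof of Thm. 6.11; [LangeBirkenhake1992]
  Prop. 8.1.1): on a uniformised complex abelian variety `φ : ℂ^g/Φ(ℤ^{2g}) → A(ℂ)` with an ample `Θ` all of whose
  Appell–Humbert data have integral Gram `E_δ`, the Riemann form of `𝒪(Θ)^an` (★ `exists_ahData_isRiemannForm_of_isAmple`)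
  has lattice Gram `E_δ` (★ `map_intGram`), so `Z := Δ Π_μ⁻¹ Π_λ ∈ 𝔥_g` for the period matrix `Π` of `Φ` in the standard
  coframe, `Φ` is `J(Z)`-linear (★ `siegelPoint_of_latticeGram_eq_typeForm`) and `A` is marked by `[J(Z), r]` with `γ = 1`,
  `Ψ = Φ`, `toFun = φ` (★ `exists_siegelAdelicMarking_of_latticeGram_eq_typeForm`).
* §3 `exists_local_periodMatrix` — THE LOCAL PERIOD FORMULA ([VoisinHodgeI2002] Thm. 10.3 + Thm. 10.9; [Griffiths1968PeriodsII]
  Thm. 1.1): Griffiths' theorem with PINNED algebraic chart (★ `griffiths1968_holomorphicHodgeSubbundlesQP_algebraicChart`) run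
  DIRECTLY on `univFamilyℂ 𝓜` ((U)-free inputs ★ `isSmoothProjectiveFamily_univFamilyℂ_of_classify`, (F-c′)/(F-c″)) at
  `t₁ ∈ W` gives holomorphic frames `wᵢ(t)` of `F¹H¹(X_t)` written on `H¹(X_{t₁})`; rational transport along a path of the
  Griffiths ball (★ `exists_ratTransport`) and the pinned iso carry them to `(1,0)`-frames of `A_t` (★
  `hodgeFrame_transport_of_iso`; `r = g` by ★ `card_hodgeFrame_eq_dim_of_iso`), whose canonical-lattice-coordinate matrix
  `P(t)` computes `π t = Δ P(t)_μ⁻¹ P(t)_λ` (★ `siegelPoint_eq_of_hodgeFrame_of_apply_jOfSiegel`) and is entrywise a FIXED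
  functional of `wᵢ(t)` (★ `latticeCoord_transport_eq_fixedFunctional'`: `γ` is flat and is the markings' lattice frame),
  hence analytic in the chart (★ `analyticOnNhd_comp_algebraicChart_symm_of_univ`).

## References

* [LangeBirkenhake1992] H. Lange, Ch. Birkenhake, *Complex Abelian Varieties* (1992), Ch. 8 §8.1–8.2 (Prop. 8.1.1).
* [VoisinHodgeI2002] C. Voisin, *Hodge Theory and Complex Algebraic Geometry I* (2002), §9.2.1, §10.1.2 Thm. 10.9, §10.2.1 Thm. 10.3.
* [Griffiths1968PeriodsII] P. Griffiths, Periods of integrals on algebraic manifolds II, Amer. J. Math. 90 (1968), Thm. 1.1.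
* [Milne2005ShimuraVarieties] J. S. Milne, *Introduction to Shimura Varieties* (2005), §6 Thm. 6.11 pp. 74–75.
* [Lange2023AbelianVarietiesComplex] H. Lange, *Abelian Varieties over the Complex Numbers* (2023), §1.1.3 Lemma 1.1.17 (a) (p. 14),
  §2.1.3 Prop. 2.1.11 (p. 80), §7.1.2 Lemma 7.1.6 (pp. 350–352).
-/

set_option autoImplicit false
set_option linter.dupNamespace false

noncomputable section

open CategoryTheory CategoryTheory.Limits AlgebraicGeometry Matrix Topology
open Literature.AlgebraicGeometry
open scoped TensorProduct Manifold
open Literature.AlgebraicGeometry.Motives (SchemeOver ComplexPoints AlgPoints specOver AbelianVariety CartierDivisor fiberOver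
  IsSmoothProjective ofRatClassBaseChange)
open Literature.AlgebraicGeometry.AbelianSchemes (PolarizedAbelianSchemeWithLevel AbelianSchemeOver)
open Literature.Geometry.Kaehler (ComplexTorus)
open Literature.Geometry.Kaehler.ComplexTorus (AHData periodMatrix intGram latticeGram IsRiemannForm proj picClass)
open Literature.NumberTheory.Transcendental (IsAnalytification)
open Literature.NumberTheory.Automorphic (siegelUpperHalfSpace)
open Literature.NumberTheory.Adeles
open Literature.AlgebraicTopology.SingularHomology
open Literature.AlgebraicGeometry.ModuliOfAbelianVarieties
open Literature.AlgebraicGeometry.HodgeTheory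

namespace Summit.HodgeConjecture.HodgeConjecture.Theorems

namespace UeP4bHodgeFrameMarkings

open SiegelModuli
/-! ### §1 Changing the uniformisation currency of a marking (`Ψ = Φ`, `toFun = φ`) -/

section Currency

variable {g : ℕ} {δ : Fin g → ℕ} {J : C0pm δ} {a : gspFinAdelic δ} {A : AbelianVariety ℂ}

/-- **The `E_δ`-Gram clause passes from a marking's own uniformisation to an equal one**: if `m.Ψ = Φ` and
`m.toFun = φ` pointwise, the statement «every Appell–Humbert datum of `𝒪(Θ)^an` (pulled back along the marking's
analytification) has integral Gram matrix `E_δ`» for `(m.Ψ, m.toFun)` implies the same for `(Φ, φ)` (destructure the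
marking; the two analytification proofs are equal by proof irrelevance). [cite: LangeBirkenhake1992, Ch. 8 §8.1] -/
theorem gramClause_of_marking (m : SiegelAdelicMarking J a A) {Φ : (Fin g ⊕ Fin g → ℝ) ≃L[ℝ] (Fin g → ℂ)}
    (hΨ : m.Ψ = Φ) {φ : ComplexTorus Φ → A.Points ℂ} (hu : ∀ t, m.toFun t = φ t)
    (hφ : IsAnalytification (Fin g → ℂ) A.X A.dim φ) (Θ : CartierDivisor A.X.left) {G : Matrix _ _ ℤ}
    (h : ∀ p : AHData m.Ψ, AHData.toPic p = picClass (cartierDivisorLineBundle m.isAnalytification Θ) →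
      intGram m.Ψ p.form = G) :
    ∀ p : AHData Φ, AHData.toPic p = picClass (cartierDivisorLineBundle hφ Θ) → intGram Φ p.form = G := by
  obtain ⟨γ, hγ, Ψ, ΨJ, u, hu', hadd⟩ := m
  dsimp only at hΨ hu h
  subst hΨ
  obtain rfl : u = φ := funext hu
  exact h

/-- Conversely, the `E_δ`-Gram clause for `(Φ, φ)` gives it for the marking's own uniformisation.
[cite: LangeBirkenhake1992, Ch. 8 §8.1] -/
theorem gramClause_to_marking (m : SiegelAdelicMarking J a A) {Φ : (Fin g ⊕ Fin g → ℝ) ≃L[ℝ] (Fin g → ℂ)}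
    (hΨ : m.Ψ = Φ) {φ : ComplexTorus Φ → A.Points ℂ} (hu : ∀ t, m.toFun t = φ t)
    (hφ : IsAnalytification (Fin g → ℂ) A.X A.dim φ) (Θ : CartierDivisor A.X.left) {G : Matrix _ _ ℤ}
    (h : ∃ p : AHData Φ, AHData.toPic p = picClass (cartierDivisorLineBundle hφ Θ) ∧ intGram Φ p.form = G) :
    ∃ p : AHData m.Ψ, AHData.toPic p = picClass (cartierDivisorLineBundle m.isAnalytification Θ) ∧
      intGram m.Ψ p.form = G := by
  obtain ⟨γ, hγ, Ψ, ΨJ, u, hu', hadd⟩ := m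
  dsimp only at hΨ hu ⊢
  subst hΨ
  obtain rfl : u = φ := funext hu
  exact h

/-- **The frame clause in the marking's currency**: `(e ∘ m.toFun)^* γₐ = ξₐ(m.Ψ)` from `(e ∘ φ)^* γₐ = ξₐ(Φ)`.
[cite: Lange2023AbelianVarietiesComplex, §1.1.3 Lemma 1.1.17 (a) (p. 14)] -/
theorem frameClause_to_marking (m : SiegelAdelicMarking J a A) {Φ : (Fin g ⊕ Fin g → ℝ) ≃L[ℝ] (Fin g → ℂ)}
    (hΨ : m.Ψ = Φ) {φ : C(ComplexTorus Φ, A.Points ℂ)} (hu : ∀ t, m.toFun t = φ t) {Y : Type}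
    [TopologicalSpace Y] (e : C(A.Points ℂ, Y)) {γ : singularCohomology ℚ ℚ Y 1} {b : Fin g ⊕ Fin g}
    (h : singularCohomology.map ℚ ℚ (e.comp φ) 1 γ = latticeClass Φ b) :
    singularCohomology.map ℚ ℚ (e.comp ⟨m.toFun, m.isAnalytification.isHomeomorph.continuous⟩) 1 γ =
      latticeClass m.Ψ b := by
  obtain ⟨γ', hγ', Ψ, ΨJ, u, hu', hadd⟩ := m
  dsimp only at hΨ hu ⊢
  subst hΨ
  obtain rfl : u = ⇑φ := funext hu
  exact h

end Currency

/-! ### §2 Per fibre: the marking `[J(Δ Π_μ⁻¹ Π_λ), r]` of a uniformised abelian variety with ample `Θ` of Gram `E_δ` -/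

section PerFibre

variable {g : ℕ} {δ : Fin g → ℕ}

/-- **PER-FIBRE MARKING OF A UNIFORMISED ABELIAN VARIETY WITH AMPLE `Θ` OF GRAM `E_δ`** (★ L4
`exists_siegelAdelicMarking_of_latticeGram_eq_typeForm` fed with the Riemann form of `𝒪(Θ)^an`, ★
`exists_ahData_isRiemannForm_of_isAmple`, whose lattice Gram is `E_δ` by hypothesis and ★ `map_intGram`).  DATA: an additive
analytification `φ : ℂ^g/Φ(ℤ^{2g}) → A(ℂ)`, an ample `Θ` all of whose Appell–Humbert data have integral Gram `E_δ`, and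
`r ∈ K_δ(1)`.  CONCLUSION, with `Π := periodMatrix (Pi.basisFun) Φ` and `Z := Δ Π_μ⁻¹ Π_λ`: `Z ∈ 𝔥_g`, `Φ` is `ℂ`-linear for
`J(Z)`, some AH datum of `𝒪(Θ)^an` has Gram `E_δ`, and `A` is marked by `[J(Z), r]` with `γ = 1`, `Ψ = Φ`, `toFun = φ`,
`r v = φ [ṽ]`. [cite: Milne2005ShimuraVarieties, §6 Thm. 6.11 pp. 74–75] [cite: LangeBirkenhake1992, §8.1 Prop. 8.1.1]
[cite: Lange2023AbelianVarietiesComplex, §2.1.3 Prop. 2.1.11 (p. 80)] -/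
theorem exists_marking_of_gramClause (hδ : IsPolarizationType δ) (A : AbelianVariety ℂ)
    {Φ : (Fin g ⊕ Fin g → ℝ) ≃L[ℝ] (Fin g → ℂ)} (φ : C(ComplexTorus Φ, A.Points ℂ))
    (hφ : IsAnalytification (Fin g → ℂ) A.X A.dim φ) (hadd : ∀ s t, φ (s + t) = φ s * φ t)
    (Θ : CartierDivisor A.X.left) (hΘ : Θ.IsAmple)
    (hG : ∀ p : AHData Φ, AHData.toPic p = picClass (cartierDivisorLineBundle hφ Θ) → intGram Φ p.form = typeForm δ)
    {r : gspFinAdelic δ} (hr : r ∈ principalLevelSubgroup δ 1) :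
    ∃ (hZ : Matrix.diagonal (fun i ↦ (δ i : ℂ)) * ((periodMatrix (Pi.basisFun ℂ (Fin g)) Φ).toCols₂)⁻¹ *
          (periodMatrix (Pi.basisFun ℂ (Fin g)) Φ).toCols₁ ∈ siegelUpperHalfSpace g),
      (∀ v, Φ (jOfSiegel δ (Matrix.diagonal (fun i ↦ (δ i : ℂ)) *
          ((periodMatrix (Pi.basisFun ℂ (Fin g)) Φ).toCols₂)⁻¹ * (periodMatrix (Pi.basisFun ℂ (Fin g)) Φ).toCols₁) *ᵥ v) =
        Complex.I • Φ v) ∧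
      (∃ p : AHData Φ, AHData.toPic p = picClass (cartierDivisorLineBundle hφ Θ) ∧ intGram Φ p.form = typeForm δ) ∧
      ∃ m : SiegelAdelicMarking ⟨jOfSiegel δ _, SiegelComplexRecordSystem.jOfSiegel_mem_C0pm hδ.1 hZ⟩ r A,
        m.γ = 1 ∧ m.Ψ = Φ ∧ (∀ t, m.toFun t = φ t) ∧
          ∀ v : Fin g ⊕ Fin g → ℚ, m.r v = φ (ComplexTorus.proj Φ fun i => (v i : ℝ)) := by
  classical
  -- put the chart on the model `ℂ^{dim A}` (`g := dim A`)
  obtain rfl : g = A.dim := by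
    have h := hφ.finrank_eq
    rw [Module.finrank_fintype_fun_eq_card, Fintype.card_fin] at h
    exact h
  -- the Riemann form of `𝒪(Θ)^an` and its Gram matrix
  obtain ⟨p, hp, hRF⟩ := A.exists_ahData_isRiemannForm_of_isAmple hφ hadd hΘ
  have hGp : intGram Φ p.form = typeForm δ := hG p hp
  have hgram : latticeGram Φ p.form = (typeForm δ).map (Int.cast : ℤ → ℝ) := by
    rw [← ComplexTorus.map_intGram Φ p.isNSForm_form, hGp]
  obtain ⟨-, hZ, -, hJ⟩ := siegelPoint_of_latticeGram_eq_typeForm Φ hRF hδ.1 hgram (Pi.basisFun ℂ (Fin A.dim))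
  obtain ⟨hZ', m, hγ, hΨ, hu, hrv⟩ := exists_siegelAdelicMarking_of_latticeGram_eq_typeForm A (φ : ComplexTorus Φ → A.Points ℂ)
    hφ hadd hRF hδ.1 hgram (Pi.basisFun ℂ (Fin A.dim)) hr
  exact ⟨hZ, hJ, ⟨p, hp, hGp⟩, m, hγ, hΨ, hu, hrv⟩

end PerFibre

/-! ### §3 The local period formula `π = Δ · P_μ⁻¹ · P_λ` near each point of `W`, `P` chart-analytic (Griffiths) -/

section Local

variable {g N : ℕ} {δ : Fin g → ℕ}

/-- **LOCAL PERIOD FORMULA.**  Setting of (B1b) without markings: the complexified universal family `X ⊗ ℂ → M ⊗ ℂ` of a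
Siegel fine moduli scheme ((F-c′)/(F-c″) for the Griffiths input), an open `W ⊆ (M ⊗ ℂ)(ℂ)` over which the family is
cohomologically locally trivial, fibre triples `P′ x` with their pinned identifications `e x : A_x(ℂ) ≃ₜ X_x(ℂ)`, a frame
`γ` of `H¹` flat inside `W`, uniformisations `(Φ x, φ x)` of the `A_x` framing `γ x` through `e x`, and period points
`π x ∈ 𝔥_g` for which `Φ x` is `J(π x)`-linear.  CONCLUSION: around every `t₁ ∈ W` there are an open `W₂ ∋ t₁` inside `W`
and inside the algebraic chart at `t₁`, and a matrix function `P` on `(M ⊗ ℂ)(ℂ)`, analytic in that chart on `W₂`, with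
`det P(t)_μ ≠ 0` and `π t = Δ · P(t)_μ⁻¹ · P(t)_λ` for all `t ∈ W₂`.  ROAD: Griffiths' holomorphic frame `wᵢ(t)` of
`F¹H¹(X_t)` read on `H¹(X_{t₁})` (★ `griffiths1968_holomorphicHodgeSubbundlesQP_algebraicChart`, run on `univFamilyℂ 𝓜`
itself), carried to `A_t` (★ `hodgeFrame_transport_of_iso`, `r = g` by ★ `card_hodgeFrame_eq_dim_of_iso`), whose
lattice-coordinate matrix computes `π t` (★ `siegelPoint_eq_of_hodgeFrame_of_apply_jOfSiegel`) and is, entrywise, a FIXED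
functional of `wᵢ(t)` (★ `latticeCoord_transport_eq_fixedFunctional'`), hence analytic.
[cite: VoisinHodgeI2002, §10.2.1 Thm. 10.3 and §10.1.2 Thm. 10.9] [cite: LangeBirkenhake1992, Ch. 8 §8.1 (Prop. 8.1.1)]
[cite: Griffiths1968PeriodsII, Thm. 1.1] -/
theorem exists_local_periodMatrix (hδ : IsPolarizationType δ) (𝓜 : SiegelFineModuliScheme g N δ)
    (hMq : IsQuasiProjectiveOver 𝓜.M) (hXq : IsQuasiProjectiveOver (W1.univTotal 𝓜))
    (d : ℕ) [SmoothOfRelativeDimension d ((Motives.baseChange ℚ ℂ).obj 𝓜.M).hom]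
    [LocallyOfFiniteType ((Motives.baseChange ℚ ℂ).obj 𝓜.M).hom]
    [IsLocallyNoetherian (specOver ℚ ℂ).left]
    {W : Set (ComplexPoints ((Motives.baseChange ℚ ℂ).obj 𝓜.M))} (hWo : IsOpen W)
    (hU : IsCohomologicallyLocallyTrivialOn (W1.univFamilyℂ 𝓜) W)
    (P' : W → PolarizedAbelianSchemeWithLevel g N δ (specOver ℚ ℂ).left)
    (G : ∀ x : W, (P' x).A.X.left ⟶ 𝓜.univ.A.X.left) (Ĝ : ∀ x : W, (P' x).D.hat.X.left ⟶ 𝓜.univ.D.hat.X.left)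
    (hbc : ∀ x : W, (P' x).IsBaseChangeVia 𝓜.univ
      ((AlgPoints.baseChangeEquiv (algebraMap ℚ ℂ) 𝓜.M).symm x.1).left (G x) (Ĝ x))
    (γ : ∀ x : W, Fin g ⊕ Fin g →
      singularCohomology ℚ ℚ (ComplexPoints (fiberOver (W1.univFamilyℂ 𝓜) x.1)) 1)
    (hflat : ∀ (x x' : W) (p : Path.Homotopic.Quotient x x') (a : Fin g ⊕ Fin g),
      transportFun (W1.univFamilyℂ 𝓜) 1 hU p
          (ofRatClass (ComplexPoints (fiberOver (W1.univFamilyℂ 𝓜) x.1)) 1 (γ x a)) =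
        ofRatClass (ComplexPoints (fiberOver (W1.univFamilyℂ 𝓜) x'.1)) 1 (γ x' a))
    (Φ : ∀ _x : W, (Fin g ⊕ Fin g → ℝ) ≃L[ℝ] (Fin g → ℂ))
    (φ : ∀ x : W, C(ComplexTorus (Φ x), ((P' x).A.fibre (𝟙 (Spec (CommRingCat.of ℂ)))).toAbelianVariety.Points ℂ))
    (hφ : ∀ x : W, IsAnalytification (Fin g → ℂ)
      ((P' x).A.fibre (𝟙 (Spec (CommRingCat.of ℂ)))).toAbelianVariety.X
      ((P' x).A.fibre (𝟙 (Spec (CommRingCat.of ℂ)))).toAbelianVariety.dim (φ x))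
    (hframe : ∀ (x : W) (a : Fin g ⊕ Fin g),
      singularCohomology.map ℚ ℚ
          (((Motives.AlgPoints.homeomorphOfIso (L := ℂ)
              (W1.fibreAVIso (P' x) ≪≫
                (W1.fiberUnivIsoOfIsBaseChangeVia 𝓜 x.1 (P' x) (G x) (Ĝ x) (hbc x)).symm) :
              ((P' x).A.fibre (𝟙 (Spec (CommRingCat.of ℂ)))).toAbelianVariety.Points ℂ ≃ₜ
                ComplexPoints (fiberOver (W1.univFamilyℂ 𝓜) x.1)) :
            C(((P' x).A.fibre (𝟙 (Spec (CommRingCat.of ℂ)))).toAbelianVariety.Points ℂ,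
              ComplexPoints (fiberOver (W1.univFamilyℂ 𝓜) x.1))).comp (φ x)) 1 (γ x a) =
        latticeClass (Φ x) a)
    (π : W → Matrix (Fin g) (Fin g) ℂ) (hπ : ∀ x, π x ∈ siegelUpperHalfSpace g)
    (hJ : ∀ (x : W) (v : Fin g ⊕ Fin g → ℝ), Φ x (jOfSiegel δ (π x) *ᵥ v) = Complex.I • Φ x v) (t₁ : W) :
    ∃ W₂ : Set (ComplexPoints ((Motives.baseChange ℚ ℂ).obj 𝓜.M)), IsOpen W₂ ∧ t₁.1 ∈ W₂ ∧ W₂ ⊆ W ∧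
      W₂ ⊆ (ComplexPoints.algebraicChart ((Motives.baseChange ℚ ℂ).obj 𝓜.M) d t₁.1).source ∧
      ∃ P : ComplexPoints ((Motives.baseChange ℚ ℂ).obj 𝓜.M) → Matrix (Fin g) (Fin g ⊕ Fin g) ℂ,
        (∀ i a, AnalyticOnNhd ℂ
          ((fun y ↦ P y i a) ∘ (ComplexPoints.algebraicChart ((Motives.baseChange ℚ ℂ).obj 𝓜.M) d t₁.1).symm)
          (ComplexPoints.algebraicChart ((Motives.baseChange ℚ ℂ).obj 𝓜.M) d t₁.1 '' W₂)) ∧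
        ∀ (t : ComplexPoints ((Motives.baseChange ℚ ℂ).obj 𝓜.M)) (ht : t ∈ W), t ∈ W₂ →
          IsUnit (P t).toCols₂.det ∧
            π ⟨t, ht⟩ = Matrix.diagonal (fun i ↦ (δ i : ℂ)) * ((P t).toCols₂)⁻¹ * (P t).toCols₁ := by
  classical
  -- the complexified universal family is a smooth projective family with quasi-projective base and total space
  have hf : Motives.IsSmoothProjectiveFamily (W1.univFamilyℂ 𝓜) g := UnivFamilyHodgeFrames.isSmoothProjectiveFamily_univFamilyℂ_of_classify 𝓜
  have hS : IsQuasiProjectiveOver ((Motives.baseChange ℚ ℂ).obj 𝓜.M) := UnivFamilyHodgeFrames.isQuasiProjectiveOver_baseChange_M 𝓜 hMq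
  have h𝒳 : IsQuasiProjectiveOver ((Motives.baseChange ℚ ℂ).obj (W1.univTotal 𝓜)) :=
    IsQuasiProjectiveOver.baseChangeHom (algebraMap ℚ ℂ) hXq
  have hUu : IsCohomologicallyLocallyTrivialOn (W1.univFamilyℂ 𝓜) (Set.univ : Set (ComplexPoints ((Motives.baseChange ℚ ℂ).obj 𝓜.M))) :=
    isCohomologicallyLocallyTrivialOn_univ_of_isSmoothProjectiveFamily (W1.univFamilyℂ 𝓜) d hf hS
  have hrat : ∀ (s t : (Set.univ : Set (ComplexPoints ((Motives.baseChange ℚ ℂ).obj 𝓜.M)))) (q : Path.Homotopic.Quotient s t)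
      (α : complexBetti (fiberOver (W1.univFamilyℂ 𝓜) s.1) 1), IsRationalClass α → IsRationalClass (transportFun (W1.univFamilyℂ 𝓜) 1 hUu q α) :=
    fun s t q α hα ↦ isRationalClass_transportFun_of_isSmoothProjectiveFamily (W1.univFamilyℂ 𝓜) 1 d hf hS q hα
  -- Hodge-symmetric Hodge models of the fibres
  have hBex : ∀ t : ComplexPoints ((Motives.baseChange ℚ ℂ).obj 𝓜.M), ∃ B : HodgeModel g (fiberOver (W1.univFamilyℂ 𝓜) t), B.IsHodgeSymmetric := fun t ↦ by
    obtain ⟨B, hB⟩ := exists_isReal_hodgeModel_holds g _ (hf.isSmoothProjective t)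
    exact ⟨B, hB.isHodgeSymmetric⟩
  choose B hB using hBex
  -- the marked abelian varieties, their identifications with the fibres, their dimension
  have hAdim : ∀ x : W, (W1.fibreAV (P' x)).dim = g := fun x ↦ W1.fibreAV_dim (P' x)
  have hAsp : ∀ x : W, IsSmoothProjective (W1.fibreAV (P' x)).dim (W1.fibreAV (P' x)).X := fun x ↦ AbelianVariety.isSmoothProjective_holds
  -- Griffiths, pinned chart, at `t₁`, reference fibre `t₁`, inside `W`
  set s₁ : (Set.univ : Set (ComplexPoints ((Motives.baseChange ℚ ℂ).obj 𝓜.M))) := ⟨t₁.1, Set.mem_univ _⟩ with hs₁def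
  have hN : (Subtype.val ⁻¹' W : Set (Set.univ : Set (ComplexPoints ((Motives.baseChange ℚ ℂ).obj 𝓜.M)))) ∈ 𝓝 s₁ :=
    (hWo.preimage continuous_subtype_val).mem_nhds (show t₁.1 ∈ W from t₁.2)
  obtain ⟨W₂, hW₂o, hs₁W₂, hW₂N, hW₂pc, ψ, hW₂ψ, hψ, hGr⟩ :=
    griffiths1968_holomorphicHodgeSubbundlesQP_algebraicChart (f := W1.univFamilyℂ 𝓜) (d := d) 1 hf hS h𝒳 hUu B hB s₁ s₁ _ hN
  obtain ⟨r, w, hframes, hanal⟩ := hGr (LinearEquiv.refl ℚ _)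
    ⟨Path.Homotopic.Quotient.refl s₁, fun v ↦ by rw [LinearEquiv.refl_apply, transportFun_refl]⟩ 1
  -- for every point of `W₂`: a path from `t₁` inside `W₂`, the rational transport along it, the frame at that point
  have hpt : ∀ t : (Set.univ : Set (ComplexPoints ((Motives.baseChange ℚ ℂ).obj 𝓜.M))), t ∈ W₂ →
      ∃ (ε : Path s₁ t) (_ : ∀ u, ε u ∈ W₂)
        (T : singularCohomology ℚ ℚ (ComplexPoints (fiberOver (W1.univFamilyℂ 𝓜) s₁.1)) 1 ≃ₗ[ℚ]
          singularCohomology ℚ ℚ (ComplexPoints (fiberOver (W1.univFamilyℂ 𝓜) t.1)) 1),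
        (∀ v, ofRatClass (ComplexPoints (fiberOver (W1.univFamilyℂ 𝓜) t.1)) 1 (T v) =
          transportFun (W1.univFamilyℂ 𝓜) 1 hUu ⟦ε⟧ (ofRatClass (ComplexPoints (fiberOver (W1.univFamilyℂ 𝓜) s₁.1)) 1 v)) ∧
        LinearIndependent ℂ (fun i ↦ w i t) ∧
          (((B t.1).hodgeStructure (hf.isSmoothProjective t.1) (hB t.1) 1).comapEquiv T).F 1 =
            Submodule.span ℂ (Set.range fun i ↦ w i t) := by
    intro t ht
    have hj : JoinedIn W₂ s₁ t := hW₂pc.joinedIn s₁ hs₁W₂ t ht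
    obtain ⟨T, hT⟩ := exists_ratTransport (W1.univFamilyℂ 𝓜) 1 hUu hrat ⟦hj.somePath⟧
    obtain ⟨hli, hF⟩ := hframes t ht hj.somePath hj.somePath_mem T
      (fun v ↦ by rw [LinearEquiv.refl_apply]; exact hT v)
    exact ⟨hj.somePath, hj.somePath_mem, T, hT, hli, hF⟩
  -- `r = g` (at the base point)
  obtain ⟨ε₁, -, T₁, hT₁, hli₁, hF₁⟩ := hpt s₁ hs₁W₂
  have hrg : r = g := by
    rw [← hAdim t₁]
    exact card_hodgeFrame_eq_dim_of_iso (W1.fibreAV (P' t₁)) (hAsp t₁) (hf.isSmoothProjective s₁.1) (B s₁.1) (hB s₁.1) T₁ hF₁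
      hli₁
      (W1.fibreAVIso (P' t₁) ≪≫ (W1.fiberUnivIsoOfIsBaseChangeVia 𝓜 t₁.1 (P' t₁) (G t₁) (Ĝ t₁) (hbc t₁)).symm) (hAdim t₁)
  subst hrg
  -- the reference uniformisation `u₁ = e t₁ ∘ φ t₁` and the fixed lattice reading `L₁`
  set u₁ : ComplexTorus (Φ t₁) ≃ₜ ComplexPoints (fiberOver (W1.univFamilyℂ 𝓜) t₁.1) :=
    (IsHomeomorph.homeomorph (φ t₁) (hφ t₁).isHomeomorph).trans
      (Motives.AlgPoints.homeomorphOfIso (L := ℂ) (W1.fibreAVIso (P' t₁) ≪≫ (W1.fiberUnivIsoOfIsBaseChangeVia 𝓜 t₁.1 (P' t₁) (G t₁) (Ĝ t₁) (hbc t₁)).symm)) with hu₁def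
  have hu₁ : ∀ b, singularCohomology.map ℚ ℚ (u₁ : C(ComplexTorus (Φ t₁), ComplexPoints (fiberOver (W1.univFamilyℂ 𝓜) t₁.1))) 1
      (γ t₁ b) = latticeClass (Φ t₁) b := fun b ↦ by
    have hcoe : (u₁ : C(ComplexTorus (Φ t₁), ComplexPoints (fiberOver (W1.univFamilyℂ 𝓜) t₁.1))) =
        (((Motives.AlgPoints.homeomorphOfIso (L := ℂ) (W1.fibreAVIso (P' t₁) ≪≫ (W1.fiberUnivIsoOfIsBaseChangeVia 𝓜 t₁.1 (P' t₁) (G t₁) (Ĝ t₁) (hbc t₁)).symm)) :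
          ((P' t₁).A.fibre (𝟙 (Spec (CommRingCat.of ℂ)))).toAbelianVariety.Points ℂ ≃ₜ
            ComplexPoints (fiberOver (W1.univFamilyℂ 𝓜) t₁.1)) :
          C(((P' t₁).A.fibre (𝟙 (Spec (CommRingCat.of ℂ)))).toAbelianVariety.Points ℂ,
            ComplexPoints (fiberOver (W1.univFamilyℂ 𝓜) t₁.1))).comp (φ t₁) :=
      ContinuousMap.ext fun _ ↦ rfl
    rw [hcoe]
    exact hframe t₁ b
  set L₁ : singularCohomology ℚ ℚ (ComplexPoints (fiberOver (W1.univFamilyℂ 𝓜) s₁.1)) 1 →ₗ[ℚ] (Fin r ⊕ Fin r → ℚ) :=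
    (latticeCoordHOne (Φ t₁)).toLinearMap ∘ₗ
      (singularCohomology.map ℚ ℚ (u₁ : C(ComplexTorus (Φ t₁), ComplexPoints (fiberOver (W1.univFamilyℂ 𝓜) t₁.1))) 1).hom with hL₁def
  -- the matrix function `P`
  set P : ComplexPoints ((Motives.baseChange ℚ ℂ).obj 𝓜.M) → Matrix (Fin r) (Fin r ⊕ Fin r) ℂ := fun y i b ↦
    TensorProduct.piScalarRight ℚ ℂ ℂ (Fin r ⊕ Fin r) (L₁.baseChange ℂ (w i ⟨y, Set.mem_univ y⟩)) b with hPdef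
  refine ⟨Subtype.val '' W₂, isOpen_univ.isOpenMap_subtype_val _ hW₂o, ⟨s₁, hs₁W₂, rfl⟩, ?_, ?_, P, ?_, ?_⟩
  · rintro _ ⟨t, ht, rfl⟩; exact hW₂N ht
  · exact Motives.ComplexPoints.image_val_subset_algebraicChart_source_of_univ t₁.1 hψ hW₂ψ
  · -- analyticity: `P y i b = Λ_{i,b} (w i y)` for the fixed functional `Λ_{i,b} = (·)_b ∘ piScalarRight ∘ (L₁ ⊗ ℂ)`
    intro i b
    set Λ : Module.Dual ℂ (ℂ ⊗[ℚ] singularCohomology ℚ ℚ (ComplexPoints (fiberOver (W1.univFamilyℂ 𝓜) s₁.1)) 1) :=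
      (LinearMap.proj b).comp ((TensorProduct.piScalarRight ℚ ℂ ℂ (Fin r ⊕ Fin r)).toLinearMap.comp (L₁.baseChange ℂ))
      with hΛdef
    have han := Motives.ComplexPoints.analyticOnNhd_comp_algebraicChart_symm_of_univ (fun y ↦ Λ (w i y)) t₁.1 hψ
      (hanal i Λ)
    exact han
  · -- the formula and the non-vanishing at every point of `W₂`
    rintro t htW ⟨t', ht', rfl⟩
    obtain ⟨ε, hε, T, hT, hli, hF⟩ := hpt t' ht'
    have hε' : ∀ u, (ε u).1 ∈ W := fun u ↦ hW₂N (hε u)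
    -- the frame carried to `A_t` ((S-3))
    obtain ⟨hli', hw'⟩ := hodgeFrame_transport_of_iso (hf.isSmoothProjective t'.1) (B t'.1) (hB t'.1) T hF hli
      (W1.fibreAVIso (P' ⟨t'.1, htW⟩) ≪≫ (W1.fiberUnivIsoOfIsBaseChangeVia 𝓜 t'.1 (P' ⟨t'.1, htW⟩) (G ⟨t'.1, htW⟩) (Ĝ ⟨t'.1, htW⟩) (hbc ⟨t'.1, htW⟩)).symm)
      (hAdim ⟨t'.1, htW⟩)
    -- its lattice-coordinate matrix IS `P t` ((S-4))
    have hP : ∀ i b, P t'.1 i b = TensorProduct.piScalarRight ℚ ℂ ℂ (Fin r ⊕ Fin r)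
        (((latticeCoordHOne (Φ ⟨t'.1, htW⟩)).toLinearMap ∘ₗ
            (singularCohomology.map ℚ ℚ (φ ⟨t'.1, htW⟩) 1).hom).baseChange ℂ
          ((singularCohomology.map ℚ ℚ
              (((Motives.AlgPoints.homeomorphOfIso (L := ℂ) (W1.fibreAVIso (P' ⟨t'.1, htW⟩) ≪≫ (W1.fiberUnivIsoOfIsBaseChangeVia 𝓜 t'.1 (P' ⟨t'.1, htW⟩) (G ⟨t'.1, htW⟩) (Ĝ ⟨t'.1, htW⟩) (hbc ⟨t'.1, htW⟩)).symm)) :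
                  ((P' ⟨t'.1, htW⟩).A.fibre (𝟙 (Spec (CommRingCat.of ℂ)))).toAbelianVariety.Points ℂ ≃ₜ
                    ComplexPoints (fiberOver (W1.univFamilyℂ 𝓜) t'.1)) :
                C(((P' ⟨t'.1, htW⟩).A.fibre (𝟙 (Spec (CommRingCat.of ℂ)))).toAbelianVariety.Points ℂ,
                  ComplexPoints (fiberOver (W1.univFamilyℂ 𝓜) t'.1))) 1).hom.baseChange ℂ
            (T.toLinearMap.baseChange ℂ (w i t')))) b := fun i b ↦
      (latticeCoord_transport_eq_fixedFunctional' (W1.univFamilyℂ 𝓜) hUu hU γ hflat t₁.2 htW ε hε' T hT u₁ hu₁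
        (Motives.AlgPoints.homeomorphOfIso (L := ℂ) (W1.fibreAVIso (P' ⟨t'.1, htW⟩) ≪≫ (W1.fiberUnivIsoOfIsBaseChangeVia 𝓜 t'.1 (P' ⟨t'.1, htW⟩) (G ⟨t'.1, htW⟩) (Ĝ ⟨t'.1, htW⟩) (hbc ⟨t'.1, htW⟩)).symm))
        (φ ⟨t'.1, htW⟩) (hframe ⟨t'.1, htW⟩) (w i t') b).symm
    exact siegelPoint_eq_of_hodgeFrame_of_apply_jOfSiegel hδ.1 (hπ ⟨t'.1, htW⟩) (Φ ⟨t'.1, htW⟩) (hJ ⟨t'.1, htW⟩)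
      (hAsp ⟨t'.1, htW⟩) (φ ⟨t'.1, htW⟩) (hφ ⟨t'.1, htW⟩)
      (by rw [Module.finrank_fintype_fun_eq_card, Fintype.card_fin]) _ hw' hli' (hP)

end Local

end UeP4bHodgeFrameMarkings

end Summit.HodgeConjecture.HodgeConjecture.Theorems

end
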